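import Mathlib

/-!
# KPlusLogSqLaw — no second step after a reach-3 step (static corridor calculus, two-speed model rung), kernel form

HONEST FRAMING.  Helper infrastructure for the conjb-2 lineage's realisable model law `HullDComb({±1,±2})` of the crux `TropicalB`
(item `stmt-ValiantsHypothesis-19771`, route `KPlusLogSqLaw`, cell `pub-symmetroid`; seat conjb-2 g21, 2026-08-29, THEORY-NOTE-g21 §3.3),
companion of `KPlusLogSqLawReachThreeStep` (LEMMA S3).  Lines `S k θ = b k + s k * θ`, `k = 0, …, 5`; a window `[i,j]` is SEPARATED at
`θ` when its even-indexed lines are strictly above its odd-indexed lines (val-sym-lift-p4's camps), and `T[i,j]` is the set of such `θ`.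
In the row calculus `J(i) = max {j : T[i,j] ≠ ∅}` is the reach of row `i`; a plateau step at row `0` of reach 3 is `J(0) = 3`, `J(1) = 4`.

* `exists_pos_right₅` : five affine functions strictly positive at `r` and a sixth vanishing at `r` with positive slope are simultaneously
  positive slightly to the right of `r` (explicit `ε`).
* `affine_pos_of_le` : an affine function with non-negative slope stays positive to the right of a point of positivity;
  `sepFull04_of_root` : the common engine (at the root of `S4 - S1`).
* `reach3_no_second_step` (LEMMA F2 of THEORY-NOTE-g21, in a form with weaker hypotheses than the pencil version) : for slopes with
  `s 1 < s 0`, `s 1 < s 2`, `s 3 < s 4`, `s 1 < s 4` (after LEMMA S3: a bad reach-3 row `λ₀, λ₁ > 0 > λ₂` whose step forced `λ₃ > 0`),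
  `T[0,3] ≠ ∅`, `T[1,4] ≠ ∅`, `T[2,5] ≠ ∅` imply `T[0,4] ≠ ∅ ∨ T[1,5] ≠ ∅`.  Read in the row calculus: if `J(0) = 3` and `J(1) = 4`
  then `T[2,5] = ∅`, i.e. `J(2) = 4` — the plateau stops after one step and row 2 has reach 2 (the G2 row that pays for the bad row 0 in
  the REACH-3 LOCAL LAW); and if `J(0) = 3` while `T[2,5] ≠ ∅` then already `J(1) ≥ 5`.

Plain statements about six real lines; nothing here asserts anything about `HullDComb`, `TropicalB`, `WeakLifting`, `KPlusLogSqLaw`,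
`MatrixDescartes` or `VP ≠ VNP`.  Located counterpart (conjb-2 g21, `csrc/chainfeas2 3 2 1 2 3000000 '++-+'`): no `{±1,±2}` word realises
two consecutive steps starting at a bad reach-3 row (0/32 at 3·10⁶ samples); the full two-step table has 116/512 realisable words, none
with a bad first row.
-/

set_option linter.dupNamespace false
set_option autoImplicit false

namespace Summit.ValiantsHypothesis.ValiantsHypothesis.Theorems.KPlusLogSqLawReachThreeNoSecondStep

/-- Five affine functions strictly positive at `r` (values `v k`, slopes `c k`) and a sixth one vanishing at `r` with positive slope `c6`
are all strictly positive at some `r + ε`, `ε > 0`. -/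
theorem exists_pos_right₅ (v1 v2 v3 v4 v5 c1 c2 c3 c4 c5 c6 : ℝ)
    (h1 : 0 < v1) (h2 : 0 < v2) (h3 : 0 < v3) (h4 : 0 < v4) (h5 : 0 < v5) (h6 : 0 < c6) :
    ∃ ε : ℝ, 0 < ε ∧ 0 < v1 + c1 * ε ∧ 0 < v2 + c2 * ε ∧ 0 < v3 + c3 * ε ∧ 0 < v4 + c4 * ε ∧ 0 < v5 + c5 * ε ∧
      0 < c6 * ε := by
  set M : ℝ := |c1| + |c2| + |c3| + |c4| + |c5| + 1 with hM
  set m : ℝ := min (min (min (min v1 v2) v3) v4) v5 with hm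
  have a1 := abs_nonneg c1
  have a2 := abs_nonneg c2
  have a3 := abs_nonneg c3
  have a4 := abs_nonneg c4
  have a5 := abs_nonneg c5
  have hMpos : 0 < M := by linarith
  have hm1 : m ≤ v1 :=
    le_trans (min_le_left _ _) (le_trans (min_le_left _ _) (le_trans (min_le_left _ _) (min_le_left _ _)))
  have hm2 : m ≤ v2 :=
    le_trans (min_le_left _ _) (le_trans (min_le_left _ _) (le_trans (min_le_left _ _) (min_le_right _ _)))
  have hm3 : m ≤ v3 := le_trans (min_le_left _ _) (le_trans (min_le_left _ _) (min_le_right _ _))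
  have hm4 : m ≤ v4 := le_trans (min_le_left _ _) (min_le_right _ _)
  have hm5 : m ≤ v5 := min_le_right _ _
  have hmpos : 0 < m := lt_min (lt_min (lt_min (lt_min h1 h2) h3) h4) h5
  set ε : ℝ := m / (2 * M) with hε
  have hεpos : 0 < ε := div_pos hmpos (by linarith)
  have hMε : M * ε = m / 2 := by
    rw [hε]
    field_simp
  have key : ∀ v c : ℝ, m ≤ v → |c| ≤ M → 0 < v + c * ε := by
    intro v c hv hc
    have e1 : -|c| * ε ≤ c * ε := mul_le_mul_of_nonneg_right (neg_abs_le c) hεpos.le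
    have e2 : |c| * ε ≤ M * ε := mul_le_mul_of_nonneg_right hc hεpos.le
    have e3 : -|c| * ε = -(|c| * ε) := by ring
    linarith
  exact ⟨ε, hεpos, key v1 c1 hm1 (by linarith), key v2 c2 hm2 (by linarith), key v3 c3 hm3 (by linarith),
    key v4 c4 hm4 (by linarith), key v5 c5 hm5 (by linarith), mul_pos h6 hεpos⟩

/-- An affine function with non-negative slope, positive at `x`, is positive at every `θ ≥ x`. -/
theorem affine_pos_of_le (x θ fa fb : ℝ) (hx : 0 < fa + fb * x) (hfb : 0 ≤ fb) (h : x ≤ θ) : 0 < fa + fb * θ := by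
  have p : 0 ≤ fb * (θ - x) := mul_nonneg hfb (by linarith)
  have i : fa + fb * θ = (fa + fb * x) + fb * (θ - x) := by ring
  linarith

/-- The common engine of LEMMA F2: at the root `τ` of `S4 - S1` (positive slope) the differences `S0 - S1`, `S2 - S1`, `S4 - S3`
are positive (hence also `S2 - S3`); then either `S0 - S3 > 0` at `τ` and `[0,4]` is separated slightly to the right of `τ`, or
`S0 ≤ S3 < S4 = S1 < S0` is absurd. -/
theorem sepFull04_of_root (s0 s1 s2 s3 s4 b0 b1 b2 b3 b4 τ : ℝ) (hs : 0 < s4 - s1)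
    (hD41 : b4 + s4 * τ = b1 + s1 * τ) (hD01 : b1 + s1 * τ < b0 + s0 * τ) (hD21 : b1 + s1 * τ < b2 + s2 * τ)
    (hD43 : b3 + s3 * τ < b4 + s4 * τ) :
    ∃ θ : ℝ, b1 + s1 * θ < b0 + s0 * θ ∧ b3 + s3 * θ < b0 + s0 * θ ∧ b1 + s1 * θ < b2 + s2 * θ ∧ b3 + s3 * θ < b2 + s2 * θ ∧
        b1 + s1 * θ < b4 + s4 * θ ∧ b3 + s3 * θ < b4 + s4 * θ := by
  by_cases h03 : b3 + s3 * τ < b0 + s0 * τ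
  · obtain ⟨ε, hε, e1, e2, e3, e4, e5, e6⟩ := exists_pos_right₅
      ((b0 + s0 * τ) - (b1 + s1 * τ)) ((b0 + s0 * τ) - (b3 + s3 * τ)) ((b2 + s2 * τ) - (b1 + s1 * τ))
      ((b2 + s2 * τ) - (b3 + s3 * τ)) ((b4 + s4 * τ) - (b3 + s3 * τ))
      (s0 - s1) (s0 - s3) (s2 - s1) (s2 - s3) (s4 - s3) (s4 - s1)
      (by linarith) (by linarith) (by linarith) (by linarith) (by linarith) hs
    have i1 : b0 + s0 * (τ + ε) - (b1 + s1 * (τ + ε)) = (b0 + s0 * τ - (b1 + s1 * τ)) + (s0 - s1) * ε := by ring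
    have i2 : b0 + s0 * (τ + ε) - (b3 + s3 * (τ + ε)) = (b0 + s0 * τ - (b3 + s3 * τ)) + (s0 - s3) * ε := by ring
    have i3 : b2 + s2 * (τ + ε) - (b1 + s1 * (τ + ε)) = (b2 + s2 * τ - (b1 + s1 * τ)) + (s2 - s1) * ε := by ring
    have i4 : b2 + s2 * (τ + ε) - (b3 + s3 * (τ + ε)) = (b2 + s2 * τ - (b3 + s3 * τ)) + (s2 - s3) * ε := by ring
    have i5 : b4 + s4 * (τ + ε) - (b3 + s3 * (τ + ε)) = (b4 + s4 * τ - (b3 + s3 * τ)) + (s4 - s3) * ε := by ring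
    have i6 : b4 + s4 * (τ + ε) - (b1 + s1 * (τ + ε)) = (b4 + s4 * τ - (b1 + s1 * τ)) + (s4 - s1) * ε := by ring
    refine ⟨τ + ε, ?_, ?_, ?_, ?_, ?_, ?_⟩
    · linarith
    · linarith
    · linarith
    · linarith
    · linarith
    · linarith
  · exfalso
    have h03' : b0 + s0 * τ ≤ b3 + s3 * τ := le_of_not_gt h03
    linarith

/-- **LEMMA F2 (no second step; THEORY-NOTE-g21 §3.3).**  Six lines `S k θ = b k + s k θ` with `s 1 < s 0`, `s 1 < s 2`, `s 3 < s 4`,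
`s 1 < s 4`.  If `[0,3]` is separated at `θA`, `[1,4]` at `θB` (only `S1 < S2`, `S1 < S4` there are used) and `[2,5]` at `θC`,
then `[0,4]` or `[1,5]` is separated somewhere.  (Row calculus: after a step `J(0) = 3, J(1) = 4` at a bad reach-3 row — where LEMMA S3 supplies `s 3 < s 4` — the window `[2,5]` is
never separated, so `J(2) = 4`.) -/
theorem reach3_no_second_step (s0 s1 s2 s3 s4 s5 b0 b1 b2 b3 b4 b5 θA θB θC : ℝ)
    (h10 : s1 < s0) (h12 : s1 < s2) (h34 : s3 < s4) (h14 : s1 < s4)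
    (hA01 : b1 + s1 * θA < b0 + s0 * θA) (hA03 : b3 + s3 * θA < b0 + s0 * θA)
    (hA21 : b1 + s1 * θA < b2 + s2 * θA) (hA23 : b3 + s3 * θA < b2 + s2 * θA)
    (hB21 : b1 + s1 * θB < b2 + s2 * θB) (hB41 : b1 + s1 * θB < b4 + s4 * θB)
    (hC23 : b3 + s3 * θC < b2 + s2 * θC) (hC25 : b5 + s5 * θC < b2 + s2 * θC)
    (hC43 : b3 + s3 * θC < b4 + s4 * θC) (hC45 : b5 + s5 * θC < b4 + s4 * θC) :
    (∃ θ : ℝ, b1 + s1 * θ < b0 + s0 * θ ∧ b3 + s3 * θ < b0 + s0 * θ ∧ b1 + s1 * θ < b2 + s2 * θ ∧ b3 + s3 * θ < b2 + s2 * θ ∧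
        b1 + s1 * θ < b4 + s4 * θ ∧ b3 + s3 * θ < b4 + s4 * θ) ∨
    (∃ θ : ℝ, b1 + s1 * θ < b2 + s2 * θ ∧ b3 + s3 * θ < b2 + s2 * θ ∧ b5 + s5 * θ < b2 + s2 * θ ∧
        b1 + s1 * θ < b4 + s4 * θ ∧ b3 + s3 * θ < b4 + s4 * θ ∧ b5 + s5 * θ < b4 + s4 * θ) := by
  have hs : 0 < s4 - s1 := by linarith
  -- Case 1: a B-time at or before the C-time: `[1,5]` is separated at `θC`.
  by_cases hBC : θB ≤ θC
  · right
    have d21 := affine_pos_of_le θB θC (b2 - b1) (s2 - s1) (by linarith) (by linarith) hBC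
    have d41 := affine_pos_of_le θB θC (b4 - b1) (s4 - s1) (by linarith) (by linarith) hBC
    exact ⟨θC, by linarith, hC23, hC25, by linarith, hC43, hC45⟩
  have hCB : θC < θB := lt_of_not_ge hBC
  by_cases hAC : θA ≤ θC
  · -- P = θC
    by_cases h41 : b1 + s1 * θC < b4 + s4 * θC
    · right
      have d21 := affine_pos_of_le θA θC (b2 - b1) (s2 - s1) (by linarith) (by linarith) hAC
      exact ⟨θC, by linarith, hC23, hC25, h41, hC43, hC45⟩
    · left
      have h41' : b4 + s4 * θC ≤ b1 + s1 * θC := le_of_not_gt h41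
      set τ : ℝ := (b1 - b4) / (s4 - s1) with hτ
      have hτmul : (s4 - s1) * τ = b1 - b4 := by
        rw [hτ]
        field_simp
      have hD41τ : b4 + s4 * τ = b1 + s1 * τ := by linarith
      have hCτ : θC ≤ τ := by
        rw [hτ, le_div_iff₀ hs]
        linarith
      have d01 := affine_pos_of_le θA τ (b0 - b1) (s0 - s1) (by linarith) (by linarith) (le_trans hAC hCτ)
      have d21 := affine_pos_of_le θA τ (b2 - b1) (s2 - s1) (by linarith) (by linarith) (le_trans hAC hCτ)
      have d43 := affine_pos_of_le θC τ (b4 - b3) (s4 - s3) (by linarith) (by linarith) hCτ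
      exact sepFull04_of_root s0 s1 s2 s3 s4 b0 b1 b2 b3 b4 τ hs hD41τ (by linarith) (by linarith) (by linarith)
  · -- P = θA, with θC < θA
    have hCA : θC < θA := lt_of_not_ge hAC
    have d43A := affine_pos_of_le θC θA (b4 - b3) (s4 - s3) (by linarith) (by linarith) hCA.le
    by_cases h41 : b1 + s1 * θA < b4 + s4 * θA
    · left
      exact ⟨θA, hA01, hA03, hA21, hA23, h41, by linarith⟩
    · left
      have h41' : b4 + s4 * θA ≤ b1 + s1 * θA := le_of_not_gt h41
      set τ : ℝ := (b1 - b4) / (s4 - s1) with hτ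
      have hτmul : (s4 - s1) * τ = b1 - b4 := by
        rw [hτ]
        field_simp
      have hD41τ : b4 + s4 * τ = b1 + s1 * τ := by linarith
      have hAτ : θA ≤ τ := by
        rw [hτ, le_div_iff₀ hs]
        linarith
      have d01 := affine_pos_of_le θA τ (b0 - b1) (s0 - s1) (by linarith) (by linarith) hAτ
      have d21 := affine_pos_of_le θA τ (b2 - b1) (s2 - s1) (by linarith) (by linarith) hAτ
      have d43 := affine_pos_of_le θC τ (b4 - b3) (s4 - s3) (by linarith) (by linarith) (le_trans hCA.le hAτ)
      exact sepFull04_of_root s0 s1 s2 s3 s4 b0 b1 b2 b3 b4 τ hs hD41τ (by linarith) (by linarith) (by linarith)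

end Summit.ValiantsHypothesis.ValiantsHypothesis.Theorems.KPlusLogSqLawReachThreeNoSecondStep
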